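import Summits.CriticalPhenomena.PercolationContinuityZ3.Theorems.PercNearOneGluingNoHeavyPcintKernSymZ4S7Check1
import Summits.CriticalPhenomena.PercolationContinuityZ3.Theorems.PercNearOneGluingNoHeavyPcintKernSymZ4S7Check2
import HarnessLib

/-!
# PCINT lane: `p_c^site(ℤ⁴) ≥ 0.1675` (kernel-checked B2r window certificate, memory 7 (6-step windows, 262144 codes); the tree's previous kernel bound is the memory-4 closed form `1/((d-1)+√((d-1)²+1)) = 0.1623`; printed lower bound = the bond one).

Cell `prim-pcint`, seat `prim-pcint-2` (gen 2); memo `run/shared/lean/prim/pcint/INTERVAL-PLAN.md` §14.  Does NOT build on p205010.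
Assembles the kernel-checked chunks (`…KernZ4S7Check1..2`) and applies the generic certificate theorem
`WinK.le_siteCriticalProb_of_checkSK` (`…PcintWinKernelCert`).  No external certificate, no
`native_decide`; axioms standard.  (The lane's two-implementation certificates reach further at larger memory; this is the kernel-only row.)
-/

namespace Summit.CriticalPhenomena.PercolationContinuityZ3.Theorems.Pcint

open Literature.Probability.Percolation Literature.Probability.LatticeModels Z4S7

/-- All `262144` coded Collatz–Wielandt rows check. [folklore] -/
theorem Z4S7.chkAll : WinK.allRange (WinK.nfOKS 4 5 1675 9742 99999 tbl 52610) 0 262144 = true :=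
  chk_split chkFile_1 chkFile_2

/-- **`p_c^site(ℤ⁴) ≥ 0.1675`** (kernel-checked B2r window certificate, memory 7 (6-step windows, 262144 codes); the tree's previous kernel bound is the memory-4 closed form `1/((d-1)+√((d-1)²+1)) = 0.1623`; printed lower bound = the bond one). [folklore] -/
theorem siteCriticalProb_Z4_ge_01675 : (0.1675 : ℝ) ≤ siteCriticalProb (zdGraph 4) 0 := by
  have h := WinK.le_siteCriticalProb_of_checkSK (d := 4) (m := 5) (pn := 1675) (Q := 9742) (lamN := 99999)
      (tbl := tbl) (dflt := 52610) (vlo := 52610) (vhi := 100000) (by norm_num) (by norm_num) (by norm_num) (by norm_num)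
      (by norm_num) tbl_bounds (by norm_num) (by norm_num) chkAll
  have e : ((1675 : ℕ) : ℝ) / 10 ^ 4 = 0.1675 := by norm_num
  rw [e] at h
  exact h

end Summit.CriticalPhenomena.PercolationContinuityZ3.Theorems.Pcint
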